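import Mathlib
import Summits.NavierStokesRegularity.NavierStokesRegularity.Theorems.EulerZoomLiouvillePowerGaugeEulerLiouvilleMomentFloorMember
import Summits.NavierStokesRegularity.NavierStokesRegularity.Theorems.EulerZoomLiouvillePowerGaugeEulerLiouvilleMomentFloorLaw
import Summits.NavierStokesRegularity.NavierStokesRegularity.Theorems.EulerZoomLiouvillePowerGaugeEulerLiouvilleSmallMomentLaw
import Summits.NavierStokesRegularity.NavierStokesRegularity.Theorems.EulerZoomLiouvillePowerGaugeEulerLiouvilleTwoSidedMomentLaw
import HarnessLib

/-!
# R53 «THE FLOOR» CLOSED: the moment floor, its corollaries and the two face-members, UNCONDITIONAL for `0 < ρ < 1`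
# (nsreg-p2 ROUND-53 v1.2 13ece20cecd64326; pure composition of landed pieces BY NAME — t57-F1 `TwoSidedMoment.twoSidedMomentLaw` (sfl-p1 g9,
# p706438), t57-F3a `Floor.supportDensityFloor` (LEAD g15, p705900), t57-F3 `MomentFloor.momentFloorLaw_of_twoSided_of_supportFloor` (ezl-w3 g8),
# t57-GLUE (ezl-w2 g6, p705397), t56-SM `SmallMoment.smallMomentLaw` (sfl-p1 g9, p705326), the conditional members of p706287 (LEAD g15); seat ns-sfl-p1 g9, `--supports stmt-NavierStokesRegularity-19832 --as helper`)

* `MomentFloor.twoSidedMomentLaw` / `MomentFloor.smallMomentLaw` — (F1) and the R52 upper law in the def currency of `…MomentFloorGlue`;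
* ★★★ `MomentFloor.momentFloorLaw` — THE FLOOR: a budget-class `C²` profile with `Ω ≢ 0` has `∫_{B_R}‖curl V‖^q ≥ ℓ·R^{3−q(2+ρ)}` for all large
  `R`, every `q ∈ (0,1)` (`0 < ρ < 1`) (every `q > 0` then follows from ezl-w3's `momentFloor_allOrders_of_momentFloorLaw`);
* `MomentFloor.borderlineVorticityDensity` (F4), `MomentFloor.lqVorticityExclusion` (F5) — unconditional;
* `Loc.selfSimilar_ae_eq_zero_of_hasLqVorticityC2_profile`, `Loc.selfSimilar_ae_eq_zero_of_subBorderlineC2_profile` — the faces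
  `MomentFloor.HasLqVorticity ρ V` / `MomentFloor.HasSubBorderlineVorticity ρ V` as MEMBERS of the crux class (the `hfloor` binder of the LEAD's
  p706287 members discharged; other binders verbatim; `0 < ρ ≤ ½`) — ready to be wired as `IsKinematicTameProfile` alternatives.

HONEST FRAMING: portrait laws and face-members about HYPOTHETICAL self-similar profiles in the crux class (MODEL lattice); no registered stub
of the LEAD's skeleton closes; nothing about the crux E (19832 OPEN) or NS regularity is proved here. [nsreg-p2 R53; folklore]
-/

noncomputable section

set_option linter.dupNamespace false

open MeasureTheory Set Filter Topology Metric Function TopologicalSpace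
open scoped ENNReal NNReal

namespace Summit.NavierStokesRegularity.NavierStokesRegularity.Theorems.PowerGaugeEulerLiouville

open Literature.Analysis Literature.Analysis.FunctionSpaces Literature.Analysis.FluidPDE

namespace MomentFloor

variable {ρ : ℝ}

/-- **(F1) in the def currency**: `MomentFloor.TwoSidedMomentLaw ρ V` for `0 < ρ < 1` (= `TwoSidedMoment.twoSidedMomentLaw` by `δ`).
[nsreg-p2 R53 (F1); folklore] -/
theorem twoSidedMomentLaw (hρ : 0 < ρ) (hρ1 : ρ < 1) (V : EuclideanSpace ℝ (Fin 3) → EuclideanSpace ℝ (Fin 3)) :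
    TwoSidedMomentLaw ρ V :=
  TwoSidedMoment.twoSidedMomentLaw hρ hρ1 V

/-- **R52's upper law in the def currency**: `MomentFloor.SmallMomentLaw ρ V` for `0 < ρ < 1` (= `SmallMoment.smallMomentLaw` by `δ`).
[nsreg-p2 R52 §E; folklore] -/
theorem smallMomentLaw (hρ : 0 < ρ) (hρ1 : ρ < 1) (V : EuclideanSpace ℝ (Fin 3) → EuclideanSpace ℝ (Fin 3)) :
    SmallMomentLaw ρ V :=
  SmallMoment.smallMomentLaw hρ hρ1 V

/-- ★★★ **THE FLOOR, UNCONDITIONAL** (`0 < ρ < 1`): `MomentFloor.MomentFloorLaw ρ V` — a budget-class `C²` self-similar profile whose vorticity does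
not vanish identically has `∫_{B_R}‖curl V‖^q ≥ ℓ·R^{3−q(2+ρ)}` (`ℓ > 0`) for all large `R`, every `q ∈ (0,1)`.  Composition of t57-F3
(`momentFloorLaw_of_twoSided_of_supportFloor`, ezl-w3 g8) with t57-F1 (`twoSidedMomentLaw`) and t57-F3a (`Floor.supportDensityFloor`, LEAD g15).
[nsreg-p2 R53 (F3); cite: ChaeShvydkoy2013 §4] -/
theorem momentFloorLaw (hρ : 0 < ρ) (hρ1 : ρ < 1) (V : EuclideanSpace ℝ (Fin 3) → EuclideanSpace ℝ (Fin 3)) :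
    MomentFloorLaw ρ V :=
  momentFloorLaw_of_twoSided_of_supportFloor hρ (twoSidedMomentLaw hρ hρ1 V) (Floor.supportDensityFloor hρ)

/-- **(F5) THE `L^q`-VORTICITY EXCLUSION, UNCONDITIONAL** (`0 < ρ < 1`): a budget-class profile with `∫‖curl V‖^q < ∞` for ONE `q < 3/(2+ρ)` is
irrotational (glue `lqVorticityExclusion_of_momentFloorLaw`, ezl-w2 g6, on THE FLOOR). [nsreg-p2 R53 (F5); cite: ChaeShvydkoy2013 §4 Thm 4.1] -/
theorem lqVorticityExclusion (hρ : 0 < ρ) (hρ1 : ρ < 1) (V : EuclideanSpace ℝ (Fin 3) → EuclideanSpace ℝ (Fin 3)) :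
    LqVorticityExclusion ρ V :=
  lqVorticityExclusion_of_momentFloorLaw hρ.le (momentFloorLaw hρ hρ1 V)

/-- **(F4) POSITIVE-DENSITY BORDERLINE VORTICITY, UNCONDITIONAL** (`0 < ρ < 1`): vorticity of the borderline size `λR^{−(2+ρ)}` occupies a positive
fraction of every large ball (glue `borderlineVorticityDensity_of_floor_of_smallMoment` on THE FLOOR + R52's upper law). [nsreg-p2 R53 (F4)] -/
theorem borderlineVorticityDensity (hρ : 0 < ρ) (hρ1 : ρ < 1) (V : EuclideanSpace ℝ (Fin 3) → EuclideanSpace ℝ (Fin 3)) :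
    BorderlineVorticityDensity ρ V :=
  borderlineVorticityDensity_of_floor_of_smallMoment hρ.le (momentFloorLaw hρ hρ1 V) (smallMomentLaw hρ hρ1 V)

end MomentFloor

/-! ## The two R53 faces as members (THE FLOOR discharged) -/

/-- **FACE «L^q VORTICITY» AS A MEMBER** (crux binders verbatim, `0 < ρ ≤ ½`, exact self-similarity about the origin with `C²` profile `(V,P)`,
the face `MomentFloor.HasLqVorticity ρ V`): the member is trivial — LEAD g15's `…_of_floor` member with THE FLOOR supplied by `MomentFloor.momentFloorLaw`.
[nsreg-p2 R53 (F5); cite: ChaeShvydkoy2013 §4 Thm 4.1] -/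
theorem Loc.selfSimilar_ae_eq_zero_of_hasLqVorticityC2_profile {ρ : ℝ} (hρ : 0 < ρ) (hρh : ρ ≤ 1 / 2)
    {u : ℝ → EuclideanSpace ℝ (Fin 3) → EuclideanSpace ℝ (Fin 3)} {p : ℝ → EuclideanSpace ℝ (Fin 3) → ℝ}
    {H : ℝ → EuclideanSpace ℝ (Fin 3) → EuclideanSpace ℝ (Fin 3) →L[ℝ] EuclideanSpace ℝ (Fin 3)} {c : ℝ≥0}
    (hsw : IsSuitableWeakSolutionOn (slab (EuclideanSpace ℝ (Fin 3)) (Iio 0) isOpen_Iio) 0 0 u p)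
    (hH : HasWeakSpatialGradientOn (slab (EuclideanSpace ℝ (Fin 3)) (Iio 0) isOpen_Iio) u H)
    (hgauge : ∀ a : ℝ, 0 < a →
      ENNReal.ofReal (a ^ (2 * ρ)) * cknA a (0 : ℝ × EuclideanSpace ℝ (Fin 3)) u +
          ENNReal.ofReal (a ^ ρ) * cknE a (0 : ℝ × EuclideanSpace ℝ (Fin 3)) H +
        ENNReal.ofReal (a ^ (2 * ρ)) * cknD a (0 : ℝ × EuclideanSpace ℝ (Fin 3)) p ≤ (c : ℝ≥0∞))
    {V : EuclideanSpace ℝ (Fin 3) → EuclideanSpace ℝ (Fin 3)} {P : EuclideanSpace ℝ (Fin 3) → ℝ}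
    (hu : ∀ τ : ℝ, τ < 0 → u τ = selfSimilarCollapse (1 / (2 + ρ)) 0 V τ)
    (hp : ∀ τ : ℝ, τ < 0 → p τ = selfSimilarCollapsePressure (1 / (2 + ρ)) 0 P τ)
    (hV : ContDiff ℝ 2 V) (hface : MomentFloor.HasLqVorticity ρ V) :
    uncurry u =ᵐ[volume.restrict (Iio (0 : ℝ) ×ˢ (univ : Set (EuclideanSpace ℝ (Fin 3))))] 0 :=
  Loc.selfSimilar_ae_eq_zero_of_hasLqVorticityC2_profile_of_floor hρ hρh hsw hH hgauge hu hp hV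
    (MomentFloor.momentFloorLaw hρ (by linarith) V) hface

/-- **FACE «SUB-BORDERLINE VORTICITY IN q-MEAN» AS A MEMBER** (crux binders verbatim, `0 < ρ ≤ ½`, `C²` exactly self-similar profile, the face
`MomentFloor.HasSubBorderlineVorticity ρ V`): trivial — LEAD g15's `…_of_floor` member with THE FLOOR supplied by `MomentFloor.momentFloorLaw`.
[nsreg-p2 R53 §A; folklore] -/
theorem Loc.selfSimilar_ae_eq_zero_of_subBorderlineC2_profile {ρ : ℝ} (hρ : 0 < ρ) (hρh : ρ ≤ 1 / 2)
    {u : ℝ → EuclideanSpace ℝ (Fin 3) → EuclideanSpace ℝ (Fin 3)} {p : ℝ → EuclideanSpace ℝ (Fin 3) → ℝ}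
    {H : ℝ → EuclideanSpace ℝ (Fin 3) → EuclideanSpace ℝ (Fin 3) →L[ℝ] EuclideanSpace ℝ (Fin 3)} {c : ℝ≥0}
    (hsw : IsSuitableWeakSolutionOn (slab (EuclideanSpace ℝ (Fin 3)) (Iio 0) isOpen_Iio) 0 0 u p)
    (hH : HasWeakSpatialGradientOn (slab (EuclideanSpace ℝ (Fin 3)) (Iio 0) isOpen_Iio) u H)
    (hgauge : ∀ a : ℝ, 0 < a →
      ENNReal.ofReal (a ^ (2 * ρ)) * cknA a (0 : ℝ × EuclideanSpace ℝ (Fin 3)) u +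
          ENNReal.ofReal (a ^ ρ) * cknE a (0 : ℝ × EuclideanSpace ℝ (Fin 3)) H +
        ENNReal.ofReal (a ^ (2 * ρ)) * cknD a (0 : ℝ × EuclideanSpace ℝ (Fin 3)) p ≤ (c : ℝ≥0∞))
    {V : EuclideanSpace ℝ (Fin 3) → EuclideanSpace ℝ (Fin 3)} {P : EuclideanSpace ℝ (Fin 3) → ℝ}
    (hu : ∀ τ : ℝ, τ < 0 → u τ = selfSimilarCollapse (1 / (2 + ρ)) 0 V τ)
    (hp : ∀ τ : ℝ, τ < 0 → p τ = selfSimilarCollapsePressure (1 / (2 + ρ)) 0 P τ)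
    (hV : ContDiff ℝ 2 V) (hface : MomentFloor.HasSubBorderlineVorticity ρ V) :
    uncurry u =ᵐ[volume.restrict (Iio (0 : ℝ) ×ˢ (univ : Set (EuclideanSpace ℝ (Fin 3))))] 0 :=
  Loc.selfSimilar_ae_eq_zero_of_subBorderlineC2_profile_of_floor hρ hρh hsw hH hgauge hu hp hV
    (MomentFloor.momentFloorLaw hρ (by linarith) V) hface

end Summit.NavierStokesRegularity.NavierStokesRegularity.Theorems.PowerGaugeEulerLiouville

end
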